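import Literature.IUT.HodgeTheaters.Cor53iLiftsAllAtFcirc
import Literature.AnabelianGeometry.SemiGraphs.CosetCategoriesEquivalencePull
import Literature.AnabelianGeometry.SemiGraphs.CosetCategoriesPullComp
import Mathlib.CategoryTheory.Adjunction.Unique
import HarnessLib

/-!
# [IUTchI] Cor 5.3 (i) «respectively ⊚»: the descent binder `hdesc⊚` REDUCED, at the instance `†𝒟^⊚ → †𝒟^⊛ := push ρ`,
# to the group-theoretic law «every topological automorphism of `Π` descends along `ρ : Π ↠ G` up to an inner automorphism»

S. Mochizuki, *Inter-universal Teichmüller theory I*, kurims manuscript (May 2020), §5 Cor 5.3 (i) p. 144 l. 2–11 and proof l. 37–39;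
Example 5.1 (i)/(iii) pp. 123–126 («`†𝒟^⊚ → †𝒟^⊛`»; the F-coricity of `C_F` together with [AbsTopIII] Thm 1.9 makes automorphisms of
`†𝒟^⊚` act on `†𝒟^⊛`) ([IUTchI] Cor 5.3 (i) p.144) [claim: Mochizuki2012, status: disputed] (D-0012 claim key; nothing of the series is
asserted; no side taken on [IUTchIII] Cor. 3.12).  [FrdII] Ex 1.3 (ii) p. 11 (the push-forward `φ_*` and pull-back functors on
`𝓑^temp(Π)⁰`, `φ_* ⊣ φ^*`) [cite: MochizukiFrdII2008, Ex 1.3 (ii) p.11]; [SemiAnbd] Prop 3.2 p. 35 (equivalences of connected temperoids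
are restriction along topological isomorphisms; isomorphic functors differ by inner automorphisms) [cite: MochizukiSemiAnbd2006, Prop 3.2 p.35].

PROOF-ONLY (cell abc-iut, row «COR53I-HDESC-REDUCTION», abc-iut-L5-lead gen 9 GO 12:49:59Z on the sizing memo
HOME/staging/L5/L5-t1/g13/C53I-HDESC-FROM-THM19-SIZING.md; seat abc-iut-L5-t1 gen 13; count-neutral).  abc-iut-w4-d109's
`Cor53iLiftsAllAtFcirc` displays, for a `⊚`-record `𝓕 : GlobalFrobenioid Δ Dcirc toBase0`, the law
`hdesc⊚ : ∀ Θ : Dcirc ≌ Dcirc, ∃ ΘB : 𝓕.Base ≌ 𝓕.Base, Nonempty (Θ.functor ⋙ 𝓕.baseMor ≅ 𝓕.baseMor ⋙ ΘB.functor)` — a law on the PARAMETER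
functor `toBase0`.  At print's instance the functor `†𝒟^⊚ → †𝒟^⊛` is the push-forward along a continuous open homomorphism `ρ : Π → G`
of the fundamental groups; THIS FILE proves that there `hdesc⊚` follows from the group-theoretic law

  `AutDescendsModInner ρ` :≡ `∀ φ : Π ≃ₜ* Π, ∃ (φ₀ : G ≃ₜ* G) (g : G), ∀ x, ρ (φ x) = g * φ₀ (ρ x) * g⁻¹`

(spelled out in the binders, no definition) — print's «automorphisms of `†𝒟^⊚` arise from scheme automorphisms, which act on `†𝒟^⊛`»
(≙ [AbsAnab] Lem 1.1.4 (i) + Cor 1.3.5 (NF absolute Grothendieck conjecture) + [AbsTopIII] Thm 1.9 functoriality + [IUTchI] Ex 5.1 (iii)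
F-coricity of `C_F`; registry GAP-LEDGER G-L5leadg9-1; NOT dischargeable by FACT-LIST F-0399/F-0346/F-2421, which are EXISTENCE /
synchronization rows — abc-iut-L5-t1 memo, abc-iut-lit/abc-iut-F-lit locator lines 12:53Z/12:58Z).

* §1 `CosetCat.exists_push_descends_of_autDescendsModInner` — on abc-iut-L5-t2's small coset categories: for a continuous OPEN SURJECTION
  `ρ : Π ↠ G` (`Π` Galois-countable tempered) satisfying `AutDescendsModInner ρ`, every self-equivalence `Θ` of `CosetCat Π`
  descends along `push ρ`: `∃ Θ₀ : CosetCat G ≌ CosetCat G, Θ ⋙ push ρ ≅ push ρ ⋙ Θ₀`.  PROOF: `Θ ≅ pull φ⁻¹` ([SemiAnbd] Prop 3.2,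
  `CosetCat.exists_continuousMulEquiv_nonempty_iso_pull`); `ρ ∘ φ⁻¹` and `φ₀⁻¹ ∘ ρ` differ by an inner automorphism, so
  `pull ρ ⋙ pull φ⁻¹ ≅ pull φ₀⁻¹ ⋙ pull ρ` (`pull_comp`, `nonempty_iso_pull_of_forall_conj`); passing to LEFT ADJOINTS along `push ρ ⊣ pull ρ`
  ([FrdII] Ex 1.3 (ii), `pushPullAdj`) and the adjoint equivalences `pull φ⁻¹ ⊣ pull φ`, `pull φ₀⁻¹ ⊣ pull φ₀` gives
  `pull φ⁻¹ ⋙ push ρ ≅ push ρ ⋙ pull φ₀⁻¹` (uniqueness of left adjoints) — the new square, with «inner automorphisms act ≅ id» inside.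
* §2 `CatIsomorphism.descends_of_equivalences` — descent of self-equivalences along a functor `P` transports along equivalences of its
  source and target and along isomorphisms of `P` (pure category theory; the twin of abc-iut-w4-d109's `hasLift_of_equivalences`).
* §3 `GlobalFrobenioid.hdesc_of_autDescendsModInner` — for every `⊚`-record `𝓕 : GlobalFrobenioid Δ Dcirc toBase0` whose structure functor is,
  up to equivalences `e : Dcirc ≌ CosetCat Π`, `i : BaseCat G' ≌ CosetCat G`, THE PUSH-FORWARD (`toBase0 ⋙ i ≅ e ⋙ push ρ`), the binder
  `hdesc⊚` of `GlobalFrobenioid.liftsAll_fcircBase_arith_of_desc_of_neukirchUchida` (★ p527866) holds VERBATIM, ⟸ `AutDescendsModInner ρ`.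
  NON-VACUITY: at `ρ := id_G` the law holds trivially (`φ₀ := φ`, `g := 1`); at `ρ : Π_{C_K} ↠ G_K ↪ G_F` it is exactly the F-core content.

HONEST LABEL: «hdesc⊚ REDUCED to the group-theoretic AutDescendsModInner ρ»; a reduction re-labels a displayed binder, it discharges nothing in
print's sense; typed ≠ proved for AutDescendsModInner; nothing here asserts abc proved or refuted.  No definitions, no instances.
-/

noncomputable section

namespace Literature.AnabelianGeometry.SemiGraphs

open CategoryTheory Function

namespace CosetCat

universe u

variable {P : Type u} [Group P] [TopologicalSpace P] [IsTopologicalGroup P]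
  {G : Type u} [Group G] [TopologicalSpace G] [IsTopologicalGroup G]

omit [IsTopologicalGroup P] in
/-- Pull-back along a topological AUTOMORPHISM is an equivalence of the coset category (full and faithful — abc-iut-L5-t2 — and
essentially surjective: `pull ψ (pull ψ⁻¹ Y) = Y` by `pull_comp`/`pull_id`). [cite: MochizukiFrdII2008, Ex 1.3 (ii) p.11] -/
theorem pull_isEquivalence_of_continuousMulEquiv (ψ : P ≃ₜ* P) :
    (pull ψ.toMonoidHom ψ.continuous ψ.surjective).IsEquivalence := by
  haveI : (pull ψ.toMonoidHom ψ.continuous ψ.surjective).Full := pull_full _ _ _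
  haveI : (pull ψ.toMonoidHom ψ.continuous ψ.surjective).Faithful := pull_faithful _ _ _
  haveI : (pull ψ.toMonoidHom ψ.continuous ψ.surjective).EssSurj := by
    refine ⟨fun Y => ⟨(pull ψ.symm.toMonoidHom ψ.symm.continuous ψ.symm.surjective).obj Y, ⟨eqToIso ?_⟩⟩⟩
    have hcomp : ψ.symm.toMonoidHom.comp ψ.toMonoidHom = MonoidHom.id P :=
      MonoidHom.ext fun x => ψ.symm_apply_apply x
    have h := congrArg (fun F : CosetCat P ⥤ CosetCat P => F.obj Y)
      ((pull_comp ψ.symm.toMonoidHom ψ.symm.continuous ψ.symm.surjective ψ.toMonoidHom ψ.continuous ψ.surjective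
        (by rw [hcomp]; exact continuous_id) (by rw [hcomp]; exact surjective_id)).trans
        ((pull_congr _ _ _ _ _ _ hcomp).trans pull_id))
    exact h
  exact {}

omit [IsTopologicalGroup P] [IsTopologicalGroup G] in
/-- **The square «push ρ ∘ pull φ⁻¹ ≅ pull φ₀⁻¹ ∘ push ρ»** ([FrdII] Ex 1.3 (ii) push/pull; [SemiAnbd] Prop 3.2 «inner automorphisms act
trivially up to isomorphism»): for a continuous open surjection `ρ : P ↠ G` and topological automorphisms `ψ` of `P`, `φ₀` of `G` with
`ρ (ψ x) = g · φ₀ (ρ x) · g⁻¹`, the pull-back along `ψ⁻¹` followed by the push-forward along `ρ` is isomorphic to the push-forward followed by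
the pull-back along `φ₀⁻¹`.  PROOF: `pull ρ ⋙ pull ψ⁻¹ = pull (ρ ∘ ψ⁻¹)` and `pull φ₀⁻¹ ⋙ pull ρ = pull (φ₀⁻¹ ∘ ρ)` (`pull_comp`); the two
composites differ by conjugation by any `x ∈ P` with `ρ x = g` (`nonempty_iso_pull_of_forall_conj`); then take LEFT ADJOINTS
(`pushPullAdj`, the adjoint equivalences of the automorphism pull-backs, `Adjunction.leftAdjointUniq`).
[cite: MochizukiFrdII2008, Ex 1.3 (ii) p.11] -/
theorem nonempty_pull_symm_push_iso_push_pull_symm (ρ : P →* G) (hc : Continuous ρ) (hs : Surjective ρ) (ho : IsOpenMap ρ)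
    (ψ : P ≃ₜ* P) (φ₀ : G ≃ₜ* G) (g : G) (hg : ∀ x, ρ (ψ x) = g * φ₀ (ρ x) * g⁻¹) :
    Nonempty (pull ψ.symm.toMonoidHom ψ.symm.continuous ψ.symm.surjective ⋙ push ρ ho ≅
      push ρ ho ⋙ pull φ₀.symm.toMonoidHom φ₀.symm.continuous φ₀.symm.surjective) := by
  -- notation
  let A : CosetCat P ⥤ CosetCat P := pull ψ.symm.toMonoidHom ψ.symm.continuous ψ.symm.surjective
  let B : CosetCat G ⥤ CosetCat G := pull φ₀.symm.toMonoidHom φ₀.symm.continuous φ₀.symm.surjective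
  let R : CosetCat G ⥤ CosetCat P := pull ρ hc hs
  let L : CosetCat P ⥤ CosetCat G := push ρ ho
  have adj : L ⊣ R := pushPullAdj ρ hc hs ho
  haveI hA : A.IsEquivalence := pull_isEquivalence_of_continuousMulEquiv ψ.symm
  haveI hB : B.IsEquivalence := pull_isEquivalence_of_continuousMulEquiv φ₀.symm
  -- (★) `R ⋙ A ≅ B ⋙ R`: both are pull-backs along homomorphisms `P → G` that differ by an inner automorphism
  have hcRA : Continuous (ρ.comp ψ.symm.toMonoidHom) := hc.comp ψ.symm.continuous
  have hsRA : Surjective (ρ.comp ψ.symm.toMonoidHom) := hs.comp ψ.symm.surjective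
  have hcBR : Continuous (φ₀.symm.toMonoidHom.comp ρ) := φ₀.symm.continuous.comp hc
  have hsBR : Surjective (φ₀.symm.toMonoidHom.comp ρ) := φ₀.symm.surjective.comp hs
  have hRA : R ⋙ A = pull (ρ.comp ψ.symm.toMonoidHom) hcRA hsRA := pull_comp _ _ _ _ _ _ _ _
  have hBR : B ⋙ R = pull (φ₀.symm.toMonoidHom.comp ρ) hcBR hsBR := pull_comp _ _ _ _ _ _ _ _
  obtain ⟨x, hx⟩ := hs g
  -- `ρ (ψ⁻¹ (x π x⁻¹)) = φ₀⁻¹ (ρ π)`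
  have hconj : ∀ π : P, (ρ.comp ψ.symm.toMonoidHom) (x * π * x⁻¹) = (φ₀.symm.toMonoidHom.comp ρ) π := by
    intro π
    change ρ (ψ.symm (x * π * x⁻¹)) = φ₀.symm (ρ π)
    apply φ₀.injective
    have key : ∀ y : P, φ₀ (ρ (ψ.symm y)) = g⁻¹ * ρ y * g := fun y => by
      have h := hg (ψ.symm y)
      rw [ContinuousMulEquiv.apply_symm_apply] at h
      rw [h, ← mul_assoc, ← mul_assoc, inv_mul_cancel, one_mul, mul_assoc, inv_mul_cancel, mul_one]
    rw [ContinuousMulEquiv.apply_symm_apply, key, map_mul, map_mul, map_inv, hx]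
    simp [mul_assoc]
  obtain ⟨j⟩ := nonempty_iso_pull_of_forall_conj (φ₀.symm.toMonoidHom.comp ρ) (ρ.comp ψ.symm.toMonoidHom) hcBR hsBR hcRA hsRA x hconj
  have star : R ⋙ A ≅ B ⋙ R := eqToIso hRA ≪≫ j ≪≫ eqToIso hBR.symm
  -- adjoint equivalences and composite adjunctions
  let eA := A.asEquivalence
  let eB := B.asEquivalence
  have adjAL : A ⋙ L ⊣ R ⋙ eA.inverse := eA.toAdjunction.comp adj
  have adjLB : L ⋙ B ⊣ eB.inverse ⋙ R := adj.comp eB.toAdjunction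
  -- the right adjoints agree: `R ⋙ A⁻¹ ≅ B⁻¹ ⋙ R`
  have k : R ⋙ eA.inverse ≅ eB.inverse ⋙ R :=
    calc R ⋙ eA.inverse ≅ 𝟭 _ ⋙ (R ⋙ eA.inverse) := (Functor.leftUnitor _).symm
      _ ≅ (eB.inverse ⋙ B) ⋙ (R ⋙ eA.inverse) := Functor.isoWhiskerRight eB.counitIso.symm _
      _ ≅ eB.inverse ⋙ (B ⋙ R) ⋙ eA.inverse :=
        Functor.associator _ _ _ ≪≫ Functor.isoWhiskerLeft eB.inverse (Functor.associator _ _ _).symm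
      _ ≅ eB.inverse ⋙ (R ⋙ A) ⋙ eA.inverse :=
        Functor.isoWhiskerLeft eB.inverse (Functor.isoWhiskerRight star.symm _)
      _ ≅ eB.inverse ⋙ R ⋙ (A ⋙ eA.inverse) :=
        Functor.isoWhiskerLeft eB.inverse (Functor.associator _ _ _)
      _ ≅ eB.inverse ⋙ R ⋙ 𝟭 _ := Functor.isoWhiskerLeft eB.inverse (Functor.isoWhiskerLeft R eA.unitIso.symm)
      _ ≅ eB.inverse ⋙ R := Functor.isoWhiskerLeft eB.inverse (Functor.rightUnitor _)
  exact ⟨Adjunction.leftAdjointUniq (adjAL.ofNatIsoRight k) adjLB⟩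

omit [IsTopologicalGroup G] in
/-- **Every self-equivalence of `CosetCat P` descends along `push ρ`, given `AutDescendsModInner ρ`** (the group-theoretic form of print's
«automorphisms of `†𝒟^⊚` … arise from automorphisms of the scheme, which act on `†𝒟^⊛`»): `Θ ≅ pull φ⁻¹` by [SemiAnbd] Prop 3.2
(abc-iut-L5-t2 `exists_continuousMulEquiv_nonempty_iso_pull`), `φ` descends to `φ₀` modulo an inner automorphism, and the square above gives
`Θ ⋙ push ρ ≅ push ρ ⋙ pull φ₀⁻¹`. ([IUTchI] Cor 5.3 (i) p.144) [cite: MochizukiSemiAnbd2006, Prop 3.2 p.35] [claim: Mochizuki2012, status: disputed] -/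
theorem exists_push_descends_of_autDescendsModInner [SecondCountableTopology P] (hP : IsTempered P)
    (ρ : P →* G) (hc : Continuous ρ) (hs : Surjective ρ) (ho : IsOpenMap ρ)
    (hAD : ∀ φ : P ≃ₜ* P, ∃ (φ₀ : G ≃ₜ* G) (g : G), ∀ x, ρ (φ x) = g * φ₀ (ρ x) * g⁻¹)
    (Θ : CosetCat P ≌ CosetCat P) :
    ∃ Θ₀ : CosetCat G ≌ CosetCat G, Nonempty (Θ.functor ⋙ push ρ ho ≅ push ρ ho ⋙ Θ₀.functor) := by
  obtain ⟨ψ, hcψ, hsψ, ⟨iΘ⟩⟩ := exists_continuousMulEquiv_nonempty_iso_pull hP hP Θ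
  obtain ⟨φ₀, g, hg⟩ := hAD ψ
  obtain ⟨sq⟩ := nonempty_pull_symm_push_iso_push_pull_symm ρ hc hs ho ψ φ₀ g hg
  haveI := pull_isEquivalence_of_continuousMulEquiv φ₀.symm
  refine ⟨(pull φ₀.symm.toMonoidHom φ₀.symm.continuous φ₀.symm.surjective).asEquivalence, ⟨?_⟩⟩
  exact Functor.isoWhiskerRight iΘ (push ρ ho) ≪≫ sq

omit [IsTopologicalGroup G] in
/-- NON-VACUITY of the law at the trivial datum: for `ρ := id_G` every topological automorphism descends (`φ₀ := φ`, `g := 1`).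
[cite: MochizukiSemiAnbd2006, Prop 3.2 p.35] -/
theorem autDescendsModInner_id (φ : G ≃ₜ* G) :
    ∃ (φ₀ : G ≃ₜ* G) (g : G), ∀ x, (MonoidHom.id G) (φ x) = g * φ₀ ((MonoidHom.id G) x) * g⁻¹ :=
  ⟨φ, 1, fun x => by simp⟩

end CosetCat

end Literature.AnabelianGeometry.SemiGraphs

namespace Literature.IUT.HodgeTheaters

open CategoryTheory Function Literature.AlgebraicGeometry.Frobenioids Literature.AnabelianGeometry.SemiGraphs

/-! ### §2. Descent of self-equivalences transports along equivalences of the data -/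

namespace CatIsomorphism

universe v₁ v₂ v₃ v₄ u₁ u₂ u₃ u₄

variable {C : Type u₁} [Category.{v₁} C] {D : Type u₂} [Category.{v₂} D]
  {C' : Type u₃} [Category.{v₃} C'] {D' : Type u₄} [Category.{v₄} D']

/-- **Descent is invariant under equivalence of the data `(C → D)`** (§0 p. 33: isomorphisms of categories are isomorphism classes of
equivalences; twin of abc-iut-w4-d109's `hasLift_of_equivalences`): if `P' ⋙ i ≅ e ⋙ P` for equivalences `e : C' ⥲ C`, `i : D' ⥲ D` and every
self-equivalence of `C` descends along `P`, then every self-equivalence `Θ'` of `C'` descends along `P'` — descend `e⁻¹ ∘ Θ' ∘ e` to `Θ₀`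
and take `i ∘ Θ₀ ∘ i⁻¹`. ([IUTchI] §0 p.33) [claim: Mochizuki2012, status: disputed] -/
theorem descends_of_equivalences (P : C ⥤ D) (P' : C' ⥤ D') (e : C' ≌ C) (i : D' ≌ D) (compat : P' ⋙ i.functor ≅ e.functor ⋙ P)
    (h : ∀ Θ : C ≌ C, ∃ Θ₀ : D ≌ D, Nonempty (Θ.functor ⋙ P ≅ P ⋙ Θ₀.functor)) (Θ' : C' ≌ C') :
    ∃ Θ₀' : D' ≌ D', Nonempty (Θ'.functor ⋙ P' ≅ P' ⋙ Θ₀'.functor) := by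
  obtain ⟨Θ₀, ⟨σ⟩⟩ := h (e.symm.trans (Θ'.trans e))
  refine ⟨i.trans (Θ₀.trans i.symm), ⟨?_⟩⟩
  -- `P' ≅ e ⋙ P ⋙ i⁻¹`
  have c0 : P' ≅ e.functor ⋙ P ⋙ i.inverse :=
    P'.rightUnitor.symm ≪≫ Functor.isoWhiskerLeft P' i.unitIso ≪≫ (Functor.associator _ _ _).symm ≪≫
      Functor.isoWhiskerRight compat i.inverse ≪≫ Functor.associator _ _ _
  -- the descended square, re-typed: `(e⁻¹ ⋙ Θ' ⋙ e) ⋙ P ≅ P ⋙ Θ₀`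
  have σ' : (e.inverse ⋙ Θ'.functor ⋙ e.functor) ⋙ P ≅ P ⋙ Θ₀.functor := σ
  -- `Θ' ⋙ e ⋙ P ≅ e ⋙ P ⋙ Θ₀`
  have c1 : Θ'.functor ⋙ e.functor ⋙ P ≅ e.functor ⋙ P ⋙ Θ₀.functor :=
    calc Θ'.functor ⋙ e.functor ⋙ P ≅ 𝟭 _ ⋙ (Θ'.functor ⋙ e.functor ⋙ P) := (Functor.leftUnitor _).symm
      _ ≅ (e.functor ⋙ e.inverse) ⋙ (Θ'.functor ⋙ e.functor ⋙ P) := Functor.isoWhiskerRight e.unitIso _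
      _ ≅ e.functor ⋙ (e.inverse ⋙ (Θ'.functor ⋙ e.functor ⋙ P)) := Functor.associator _ _ _
      _ ≅ e.functor ⋙ ((e.inverse ⋙ Θ'.functor ⋙ e.functor) ⋙ P) :=
        Functor.isoWhiskerLeft e.functor
          ((Functor.associator e.inverse Θ'.functor (e.functor ⋙ P)).symm ≪≫
            Functor.isoWhiskerLeft (e.inverse ⋙ Θ'.functor) (Iso.refl _) ≪≫
            (Functor.associator (e.inverse ⋙ Θ'.functor) e.functor P).symm ≪≫
            Functor.isoWhiskerRight (Functor.associator e.inverse Θ'.functor e.functor) P)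
      _ ≅ e.functor ⋙ (P ⋙ Θ₀.functor) := Functor.isoWhiskerLeft e.functor σ'
  -- `(e ⋙ P) ⋙ X ≅ (P' ⋙ i) ⋙ X`
  have c2 : e.functor ⋙ P ≅ P' ⋙ i.functor := compat.symm
  calc Θ'.functor ⋙ P' ≅ Θ'.functor ⋙ (e.functor ⋙ P ⋙ i.inverse) := Functor.isoWhiskerLeft Θ'.functor c0
    _ ≅ (Θ'.functor ⋙ e.functor ⋙ P) ⋙ i.inverse :=
      (Functor.associator _ _ _).symm ≪≫ Functor.isoWhiskerRight (Functor.associator Θ'.functor e.functor P).symm i.inverse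
        |> fun t => (Functor.isoWhiskerLeft Θ'.functor (Functor.associator e.functor P i.inverse).symm) ≪≫ t
    _ ≅ (e.functor ⋙ P ⋙ Θ₀.functor) ⋙ i.inverse := Functor.isoWhiskerRight c1 i.inverse
    _ ≅ ((e.functor ⋙ P) ⋙ Θ₀.functor) ⋙ i.inverse :=
      Functor.isoWhiskerRight (Functor.associator e.functor P Θ₀.functor).symm i.inverse
    _ ≅ ((P' ⋙ i.functor) ⋙ Θ₀.functor) ⋙ i.inverse :=
      Functor.isoWhiskerRight (Functor.isoWhiskerRight c2 Θ₀.functor) i.inverse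
    _ ≅ P' ⋙ (i.functor ⋙ Θ₀.functor ⋙ i.inverse) :=
      Functor.isoWhiskerRight (Functor.associator P' i.functor Θ₀.functor) i.inverse ≪≫
        Functor.associator P' (i.functor ⋙ Θ₀.functor) i.inverse ≪≫
        Functor.isoWhiskerLeft P' (Functor.associator i.functor Θ₀.functor i.inverse)

end CatIsomorphism

/-! ### §3. The `⊚`-record: `hdesc⊚` at the instance `†𝒟^⊚ → †𝒟^⊛ := push ρ` -/

namespace GlobalFrobenioid

universe u

variable {Gq : ProfiniteGrp.{u}} {Δ : GlobalDivisorData Gq} {Dcirc : Type (u + 1)} [Category.{u} Dcirc]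
  {toBase0 : Dcirc ⥤ BaseCat Gq} (𝓕 : GlobalFrobenioid Δ Dcirc toBase0)
  {P : Type u} [Group P] [TopologicalSpace P] [IsTopologicalGroup P] [SecondCountableTopology P]
  {G : Type u} [Group G] [TopologicalSpace G]

/-- **`hdesc⊚` REDUCED to `AutDescendsModInner ρ` at the instance `†𝒟^⊚ → †𝒟^⊛ := push ρ`.**  Let `𝓕` be a `⊚`-record (abc-iut-L5-t1's
`GlobalFrobenioid Δ Dcirc toBase0`: `†ℱ^⊛ ≌ ℱ^⊛(†𝒟^⊚)`, `Base(†ℱ^⊛) ≌ †𝒟^⊛`, `baseMor : †𝒟^⊚ → Base(†ℱ^⊛)`, `α₁`, `compat`) whose structure functor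
`toBase0 : †𝒟^⊚ → †𝒟^⊛` IS, up to equivalences `e : †𝒟^⊚ ≌ CosetCat Π` and `i : †𝒟^⊛ ≌ CosetCat G` (the small coset models of the connected
Galois categories, [FrdII] Ex 1.3 (i)), THE PUSH-FORWARD along a continuous open surjection `ρ : Π ↠ G` (`Π` Galois-countable tempered;
`toBase0 ⋙ i ≅ e ⋙ push ρ`).  If every topological automorphism of `Π` descends along `ρ` up to an inner automorphism of `G`
(`AutDescendsModInner ρ`, spelled out — print: [AbsAnab] Lem 1.1.4 (i) + Cor 1.3.5, [AbsTopIII] Thm 1.9 functoriality, [IUTchI] Ex 5.1 (iii)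
F-coricity of `C_F`; registry GAP-LEDGER G-L5leadg9-1), then the binder `hdesc⊚` of abc-iut-w4-d109's
`GlobalFrobenioid.liftsAll_fcircBase_arith_of_desc_of_neukirchUchida` HOLDS VERBATIM: every self-equivalence of `†𝒟^⊚` descends along
`baseMor` to `Base(†ℱ^⊛)`.  (§1 at `CosetCat`, transported twice by §2: along `(e, i)` to `toBase0`, then along `(α₁, identify, compat)` to
`baseMor`.)  A reduction re-labels the displayed binder; it discharges nothing in print's sense. ([IUTchI] Cor 5.3 (i) p.144)
[cite: MochizukiSemiAnbd2006, Prop 3.2 p.35] [claim: Mochizuki2012, status: disputed] -/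
theorem hdesc_of_autDescendsModInner (hP : IsTempered P)
    (ρ : P →* G) (hc : Continuous ρ) (hs : Surjective ρ) (ho : IsOpenMap ρ)
    (e : Dcirc ≌ CosetCat P) (i : BaseCat Gq ≌ CosetCat G) (hinst : toBase0 ⋙ i.functor ≅ e.functor ⋙ CosetCat.push ρ ho)
    (hAD : ∀ φ : P ≃ₜ* P, ∃ (φ₀ : G ≃ₜ* G) (g : G), ∀ x, ρ (φ x) = g * φ₀ (ρ x) * g⁻¹) :
    ∀ Θ : Dcirc ≌ Dcirc, ∃ ΘB : 𝓕.Base ≌ 𝓕.Base, Nonempty (Θ.functor ⋙ 𝓕.baseMor ≅ 𝓕.baseMor ⋙ ΘB.functor) := by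
  -- descent along `toBase0` from §1 transported along `(e, i)`
  have h0 : ∀ Θ : Dcirc ≌ Dcirc, ∃ Θ₀ : BaseCat Gq ≌ BaseCat Gq, Nonempty (Θ.functor ⋙ toBase0 ≅ toBase0 ⋙ Θ₀.functor) :=
    CatIsomorphism.descends_of_equivalences (CosetCat.push ρ ho) toBase0 e i hinst
      (CosetCat.exists_push_descends_of_autDescendsModInner hP ρ hc hs ho hAD)
  -- … then along `(α₁, identify, compat)` to `baseMor`
  exact CatIsomorphism.descends_of_equivalences toBase0 𝓕.baseMor 𝓕.α₁ 𝓕.identify 𝓕.compat.symm h0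

end GlobalFrobenioid

end Literature.IUT.HodgeTheaters
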